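import Summits.KontsevichZagierPeriods.KontsevichZagierPeriods.Theorems.HurwitzMicroSectorsNormalFormPrincipleLevelOneReduction
import Summits.KontsevichZagierPeriods.KontsevichZagierPeriods.Theorems.HurwitzMicroSectorsNormalFormPrincipleSplitMoves
import Summits.KontsevichZagierPeriods.KontsevichZagierPeriods.Theorems.HurwitzMicroSectorsNormalFormPrincipleLevelNExistsRep
import Summits.KontsevichZagierPeriods.KontsevichZagierPeriods.Theorems.HurwitzMicroSectorsNormalFormPrincipleLevelNExistsTriangleRep
import Summits.KontsevichZagierPeriods.KontsevichZagierPeriods.Theorems.HurwitzMicroSectorsNormalFormPrincipleLevelNMergeBoxSubTriangle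
import Summits.KontsevichZagierPeriods.KontsevichZagierPeriods.Theorems.HurwitzMicroSectorsNormalFormPrincipleLevelNTriangleSubDimOne
import Literature.NumberTheory.Transcendental.KZProductIdeal

/-!
# `NormalFormPrinciple` (stmt-KontsevichZagierPeriods-3869), line `SketchIdeator1` — the leaf
# `stub_boxRigidity` in dimension two, EVERY LEVEL `N`: the full box sector is its diagonal plus dimension one

Pure proof file (lead seat c7, wave 3; `--supports` the crux; registered sub-goals `levelN_reduce`,
`levelN_kernel_of_diag_kernel`). For every level `N ≥ 1` the FULL two-dimensional box sector
`[(0,1)², P(x₀,x₁)/(1 − (x₀x₁)^N)]`, `P ∈ ℚ[x₀,x₁]` — the natural completion of the route's DIAGONAL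
Hurwitz rungs `P(x₀x₁)/(1 − (x₀x₁)^N)` (closed: `(2,6)` given CDT, `(3,2)`, the parity tower) — reduces by
Kontsevich–Zagier moves to its diagonal plus dimension one, UNCONDITIONALLY:

* `levelN_reduce` — `[(0,1)², P/(1 − tᴺ)] ≡ [(0,1)², D(t)/(1 − tᴺ)] + [(0,1), p₁(s)/(1 + s + ⋯ + s^{N−1})] + [pt, q]`
  (`t = x₀x₁`; `D, p₁ ∈ ℚ[X]`, `q ∈ ℚ`): the diagonal monomials of `P` stay, each off-diagonal monomial
  `c x₀^a x₁^b`, `a > b`, is sent by the merge gadget at level `N` (rule 2, `merge_box_sub_triangle_levelN`)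
  and one Newton–Leibniz move (rule 3, `triangle_sub_dimOne_levelN`) to the dimension-one box-rational
  representation `[(0,1), (c/(a−b)) s^b (Σ_{i<a−b} sⁱ)/(Σ_{i<N} sⁱ)]` (cyclotomic denominator, pole-free
  on `[0,1]`), `a < b` by the swap symmetry; dimension-one pieces with the common denominator merge
  (rule 1b);
* `levelN_kernel_of_diag_kernel` — hence **Conjecture 1 in kernel form on the subgroup generated by
  the full level-`N` sector and all rational representations of dimension `≤ 1` FOLLOWS from the same
  statement for the DIAGONAL level-`N` sector and dimension `≤ 1`**: off the diagonal there is nothing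
  new to prove at any level. (For `N = 1, 2` the right-hand sides are settled in `…LevelOne.lean`,
  `…LevelTwo.lean` up to the stated independence inputs.)

Sources: M. Kontsevich, D. Zagier, *Periods* (2001), §1.2 Conjecture 1, rules (1)–(3). No definitions.
-/

noncomputable section

open MeasureTheory Set
open scoped Polynomial
open Literature.NumberTheory.Transcendental Literature.NumberTheory.Transcendental.KZ
open Literature.ModelTheory.ExponentialFields (IsSemialgebraic)

namespace Summit.KontsevichZagierPeriods.HurwitzMicroSectors.NormalFormPrinciple.PiBox.LevelN

open Summit.KontsevichZagierPeriods.HurwitzMicroSectors.NormalFormPrinciple.PiBox.Dlog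
  (exists_ptCarrier value_pt pt_add_mem_relations pt_zero_mem_relations pt_congr_mem_relations
   exists_rep_unit)
open Summit.KontsevichZagierPeriods.HurwitzMicroSectors.NormalFormPrinciple.PiBox.LevelOne
  (exists_boxPolyRep boxPoly_exists_pt aeval_monomial_two)

variable {Nl : ℕ}

/-! ### The cyclotomic denominator `q_N(s) = Σ_{i<N} sⁱ` -/

/-- `q_N(t) = Σ_{i<N} tⁱ ≥ 1 > 0` on `[0,1]` for `N ≥ 1`. [folklore] -/
theorem geomSum_pos_of_mem_Icc (hN : 1 ≤ Nl) {t : ℝ} (ht : t ∈ Set.Icc (0:ℝ) 1) :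
    0 < ∑ i ∈ Finset.range Nl, t ^ i := by
  obtain ⟨k, rfl⟩ : ∃ k, Nl = k + 1 := ⟨Nl - 1, by omega⟩
  rw [Finset.sum_range_succ']
  have h0 : 0 ≤ ∑ i ∈ Finset.range k, t ^ (i + 1) :=
    Finset.sum_nonneg fun i _ => pow_nonneg ht.1 _
  simp only [pow_zero]
  linarith

/-- The evaluation of `Σ_{i<N} Xⁱ ∈ ℚ[X]`. [folklore] -/
theorem aeval_geomSum (t : ℝ) :
    (Polynomial.aeval t (∑ i ∈ Finset.range Nl, Polynomial.X ^ i : ℚ[X]) : ℝ) =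
      ∑ i ∈ Finset.range Nl, t ^ i := by
  simp [map_sum]

/-- **The dimension-one representation `[(0,1), p(s)/q_N(s)]` exists** (`q_N` pole-free on `[0,1]`).
[cite: KontsevichZagier2001, §1.1] -/
theorem exists_dimOneRep_levelN (hN : 1 ≤ Nl) (p : ℚ[X]) :
    ∃ N₁ : IntegralRep 1, N₁.domain = {x | ∀ i, x i ∈ Set.Ioo (0:ℝ) 1} ∧
      EqOn N₁.integrand (fun x => (Polynomial.aeval (x 0) p : ℝ) / ∑ i ∈ Finset.range Nl, x 0 ^ i)
        N₁.domain := by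
  obtain ⟨N₁, hN₁d, hN₁i⟩ := exists_rep_unit p (∑ i ∈ Finset.range Nl, Polynomial.X ^ i)
    (fun t ht => by rw [aeval_geomSum]; exact (geomSum_pos_of_mem_Icc hN ht).ne')
  refine ⟨N₁, by rw [hN₁d, Unicoord.box_one_eq], fun x _ => ?_⟩
  rw [hN₁i]
  simp only [aeval_geomSum]

/-- Additivity of `[(0,1), p/q_N]` in `p` (rule 1b). [cite: KontsevichZagier2001, §1.2 rule (1)] -/
theorem dimOneRep_levelN_add_mem_relations {p₁ p₂ : ℚ[X]} (L L₁ L₂ : IntegralRep 1)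
    (hLd : L.domain = {x | ∀ i, x i ∈ Set.Ioo (0:ℝ) 1})
    (hLi : EqOn L.integrand
      (fun x => (Polynomial.aeval (x 0) (p₁ + p₂) : ℝ) / ∑ i ∈ Finset.range Nl, x 0 ^ i) L.domain)
    (hL₁d : L₁.domain = {x | ∀ i, x i ∈ Set.Ioo (0:ℝ) 1})
    (hL₁i : EqOn L₁.integrand
      (fun x => (Polynomial.aeval (x 0) p₁ : ℝ) / ∑ i ∈ Finset.range Nl, x 0 ^ i) L₁.domain)
    (hL₂d : L₂.domain = {x | ∀ i, x i ∈ Set.Ioo (0:ℝ) 1})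
    (hL₂i : EqOn L₂.integrand
      (fun x => (Polynomial.aeval (x 0) p₂ : ℝ) / ∑ i ∈ Finset.range Nl, x 0 ^ i) L₂.domain) :
    of L - of L₁ - of L₂ ∈ relations := by
  refine integrandAddRel_subset_relations ⟨1, L, L₁, L₂, hL₁d.trans hLd.symm, hL₂d.trans hLd.symm,
    fun x hx => ?_, rfl⟩
  have hx₁ : x ∈ L₁.domain := by rw [hL₁d, ← hLd]; exact hx
  have hx₂ : x ∈ L₂.domain := by rw [hL₂d, ← hLd]; exact hx
  rw [Pi.add_apply, hLi hx, hL₁i hx₁, hL₂i hx₂]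
  dsimp only
  rw [Polynomial.aeval_add, add_div]

/-- `[(0,1), 0/q_N] ∈ relations`. [cite: KontsevichZagier2001, §1.2 rule (1)] -/
theorem dimOneRep_levelN_zero_mem_relations (L : IntegralRep 1)
    (hLi : EqOn L.integrand
      (fun x => (Polynomial.aeval (x 0) (0 : ℚ[X]) : ℝ) / ∑ i ∈ Finset.range Nl, x 0 ^ i) L.domain) :
    of L ∈ relations :=
  of_mem_relations_of_eqOn_zero L fun x hx => by rw [hLi hx]; simp

/-! ### The diagonal carriers `[(0,1)², D(x₀x₁)/(1 − (x₀x₁)ᴺ)]` -/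

/-- The diagonal level-`N` representation with diagonal polynomial `D` exists. [cite: KontsevichZagier2001, §1.1] -/
theorem exists_diagRep_levelN (hN : 1 ≤ Nl) (D : ℚ[X]) :
    ∃ Nd : IntegralRep 2, Nd.domain = {x | ∀ i, x i ∈ Set.Ioo (0:ℝ) 1} ∧
      EqOn Nd.integrand (fun x => (Polynomial.aeval (x 0 * x 1) D : ℝ) / (1 - (x 0 * x 1) ^ Nl))
        Nd.domain := by
  obtain ⟨Nd, hd, hi⟩ := exists_levelNRep Nl hN
    (Polynomial.aeval (MvPolynomial.X 0 * MvPolynomial.X 1 : MvPolynomial (Fin 2) ℚ) D)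
  refine ⟨Nd, hd, fun x _ => ?_⟩
  rw [hi]
  simp only []
  rw [← Polynomial.aeval_algHom_apply]
  simp

/-- Additivity of the diagonal carriers in `D` (rule 1b). [cite: KontsevichZagier2001, §1.2 rule (1)] -/
theorem diagRep_levelN_add_mem_relations {D₁ D₂ : ℚ[X]} (B B₁ B₂ : IntegralRep 2)
    (hBd : B.domain = {x | ∀ i, x i ∈ Set.Ioo (0:ℝ) 1})
    (hBi : EqOn B.integrand
      (fun x => (Polynomial.aeval (x 0 * x 1) (D₁ + D₂) : ℝ) / (1 - (x 0 * x 1) ^ Nl)) B.domain)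
    (hB₁d : B₁.domain = {x | ∀ i, x i ∈ Set.Ioo (0:ℝ) 1})
    (hB₁i : EqOn B₁.integrand
      (fun x => (Polynomial.aeval (x 0 * x 1) D₁ : ℝ) / (1 - (x 0 * x 1) ^ Nl)) B₁.domain)
    (hB₂d : B₂.domain = {x | ∀ i, x i ∈ Set.Ioo (0:ℝ) 1})
    (hB₂i : EqOn B₂.integrand
      (fun x => (Polynomial.aeval (x 0 * x 1) D₂ : ℝ) / (1 - (x 0 * x 1) ^ Nl)) B₂.domain) :
    of B - of B₁ - of B₂ ∈ relations := by
  refine integrandAddRel_subset_relations ⟨2, B, B₁, B₂, hB₁d.trans hBd.symm, hB₂d.trans hBd.symm,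
    fun x hx => ?_, rfl⟩
  have hx₁ : x ∈ B₁.domain := by rw [hB₁d, ← hBd]; exact hx
  have hx₂ : x ∈ B₂.domain := by rw [hB₂d, ← hBd]; exact hx
  rw [Pi.add_apply, hBi hx, hB₁i hx₁, hB₂i hx₂]
  dsimp only
  rw [Polynomial.aeval_add, add_div]

/-- A diagonal carrier with `D = 0` is a relation. [cite: KontsevichZagier2001, §1.2 rule (1)] -/
theorem diagRep_levelN_zero_mem_relations (B : IntegralRep 2)
    (hBi : EqOn B.integrand
      (fun x => (Polynomial.aeval (x 0 * x 1) (0 : ℚ[X]) : ℝ) / (1 - (x 0 * x 1) ^ Nl)) B.domain) :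
    of B ∈ relations :=
  of_mem_relations_of_eqOn_zero B fun x hx => by rw [hBi hx]; simp

/-! ### The swap symmetry at level `N` -/

/-- **Coordinate swap at level `N`** (rule 2). [cite: KontsevichZagier2001, §1.2 rule (2)] -/
theorem swap_monomial_levelN' (a b : ℕ) (c : ℚ) (N N' : IntegralRep 2)
    (hNd : N.domain = {x | ∀ i, x i ∈ Set.Ioo (0:ℝ) 1})
    (hNi : EqOn N.integrand (fun x => (c : ℝ) * (x 0 ^ a * x 1 ^ b) / (1 - (x 0 * x 1) ^ Nl)) N.domain)
    (hN'd : N'.domain = {x | ∀ i, x i ∈ Set.Ioo (0:ℝ) 1})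
    (hN'i : EqOn N'.integrand (fun x => (c : ℝ) * (x 0 ^ b * x 1 ^ a) / (1 - (x 0 * x 1) ^ Nl)) N'.domain) :
    of N - of N' ∈ relations := by
  have h1 := of_sub_of_reindex_mem_relations N (Equiv.swap (0 : Fin 2) 1)
  have hd : (N.reindex (Equiv.swap (0 : Fin 2) 1)).domain = {x | ∀ i, x i ∈ Set.Ioo (0:ℝ) 1} := by
    ext w
    simp only [IntegralRep.reindex_domain, hNd, mem_setOf_eq, Fin.forall_fin_two,
      Equiv.swap_apply_left, Equiv.swap_apply_right]
    tauto
  have h2 : of (N.reindex (Equiv.swap (0 : Fin 2) 1)) - of N' ∈ relations := by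
    refine of_sub_of_mem_relations_of_eqOn (hN'd.trans hd.symm) fun w hw => ?_
    have hw' : (fun i => w (Equiv.swap (0 : Fin 2) 1 i)) ∈ N.domain := by
      rw [IntegralRep.reindex_domain] at hw
      exact hw
    rw [IntegralRep.reindex_integrand]
    show N.integrand (fun i => w (Equiv.swap (0 : Fin 2) 1 i)) = N'.integrand w
    rw [hNi hw', hN'i (hN'd ▸ hd ▸ hw)]
    simp only [Equiv.swap_apply_left, Equiv.swap_apply_right]
    ring
  have e : of N - of N' = (of N - of (N.reindex (Equiv.swap (0 : Fin 2) 1))) +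
      (of (N.reindex (Equiv.swap (0 : Fin 2) 1)) - of N') := by abel
  rw [e]
  exact relations.add_mem h1 h2

/-! ### Monomials -/

/-- **An off-diagonal level-`N` monomial with `a > b` is congruent to `[(0,1), p₁/q_N]`** (merge
gadget at level `N` and Newton–Leibniz). [cite: KontsevichZagier2001, §1.2] -/
theorem offDiag_levelN_of_lt (hN : 1 ≤ Nl) (a b : ℕ) (c : ℚ) (hab : b < a) (N : IntegralRep 2)
    (hNd : N.domain = {x | ∀ i, x i ∈ Set.Ioo (0:ℝ) 1})
    (hNi : EqOn N.integrand (fun x => (c : ℝ) * (x 0 ^ a * x 1 ^ b) / (1 - (x 0 * x 1) ^ Nl)) N.domain) :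
    ∃ (p₁ : ℚ[X]) (N₁ : IntegralRep 1), N₁.domain = {x | ∀ i, x i ∈ Set.Ioo (0:ℝ) 1} ∧
      EqOn N₁.integrand (fun x => (Polynomial.aeval (x 0) p₁ : ℝ) / ∑ i ∈ Finset.range Nl, x 0 ^ i)
        N₁.domain ∧ of N - of N₁ ∈ relations := by
  obtain ⟨R, hRd, hRi⟩ := exists_triangleRep_levelN Nl hN a b c hab
  have h1 := merge_box_sub_triangle_levelN Nl hN a b c hab N R hNd hNi hRd
    (by rw [hRi]; exact fun _ _ => rfl)
  set p₁ : ℚ[X] := Polynomial.C (c / ((a - b : ℕ) : ℚ)) *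
    (Polynomial.X ^ b * ∑ i ∈ Finset.range (a - b), Polynomial.X ^ i) with hp₁
  obtain ⟨N₁, hN₁d, hN₁i⟩ := exists_dimOneRep_levelN hN p₁
  have hPev : ∀ x : Fin 1 → ℝ, (Polynomial.aeval (x 0) p₁ : ℝ) =
      (c : ℝ) / ((a - b : ℕ) : ℝ) * (x 0 ^ b * ∑ i ∈ Finset.range (a - b), x 0 ^ i) := fun x => by
    rw [hp₁]
    simp [Polynomial.aeval_mul, map_sum]
  have h2 := triangle_sub_dimOne_levelN Nl hN a b c hab R N₁ hRd (by rw [hRi]; exact fun _ _ => rfl)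
    hN₁d (fun x hx => by rw [hN₁i hx]; simp only [hPev])
  refine ⟨p₁, N₁, hN₁d, hN₁i, ?_⟩
  have e : of N - of N₁ = (of N - of R) + (of R - of N₁) := by abel
  rw [e]
  exact relations.add_mem h1 h2

/-! ### The reduction: full sector = diagonal + dimension one -/

/-- **`levelN_reduce`: the full level-`N` box sector reduces to its diagonal plus dimension one.** For
every `P ∈ ℚ[x₀,x₁]` and every representation `N = [(0,1)², P/(1 − (x₀x₁)ᴺ)]` there are `D, p₁ ∈ ℚ[X]`
with `[N] ≡ [(0,1)², D(x₀x₁)/(1 − (x₀x₁)ᴺ)] + [(0,1), p₁(s)/Σ_{i<N} sⁱ]` modulo Kontsevich–Zagier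
relations (for any representations with these data). Induction on `P`: a diagonal monomial stays
(`D = c Xᵃ`, `p₁ = 0`), an off-diagonal one goes to dimension one (`offDiag_levelN_of_lt`, after the
swap if `a < b`), sums by rule (1b). [cite: KontsevichZagier2001, §1.2] -/
theorem levelN_reduce {Nl : ℕ} (hN : 1 ≤ Nl) (P : MvPolynomial (Fin 2) ℚ) :
    ∀ (N : IntegralRep 2), N.domain = {x | ∀ i, x i ∈ Set.Ioo (0:ℝ) 1} →
      EqOn N.integrand (fun x => (MvPolynomial.aeval x P : ℝ) / (1 - (x 0 * x 1) ^ Nl)) N.domain →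
      ∃ (D p₁ : ℚ[X]), ∀ (Nd : IntegralRep 2) (N₁ : IntegralRep 1),
        Nd.domain = {x | ∀ i, x i ∈ Set.Ioo (0:ℝ) 1} →
        EqOn Nd.integrand (fun x => (Polynomial.aeval (x 0 * x 1) D : ℝ) / (1 - (x 0 * x 1) ^ Nl))
          Nd.domain →
        N₁.domain = {x | ∀ i, x i ∈ Set.Ioo (0:ℝ) 1} →
        EqOn N₁.integrand (fun x => (Polynomial.aeval (x 0) p₁ : ℝ) / ∑ i ∈ Finset.range Nl, x 0 ^ i)
          N₁.domain →
        of N - of Nd - of N₁ ∈ relations := by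
  induction P using MvPolynomial.induction_on' with
  | monomial s c =>
    intro N hNd hNi
    have hNi' : EqOn N.integrand (fun x => (c : ℝ) * (x 0 ^ (s 0) * x 1 ^ (s 1)) / (1 - (x 0 * x 1) ^ Nl))
        N.domain := fun x hx => by rw [hNi hx]; simp only [aeval_monomial_two]
    by_cases hs : s 0 = s 1
    · -- diagonal monomial: it IS a diagonal carrier
      refine ⟨Polynomial.C c * Polynomial.X ^ (s 0), 0, fun Nd N₁ hNdd hNdi hN₁d hN₁i => ?_⟩
      have h1 : of N - of Nd ∈ relations := by
        refine of_sub_of_mem_relations_of_eqOn (hNdd.trans hNd.symm) fun x hx => ?_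
        rw [hNi' hx, hNdi (by rw [hNdd, ← hNd]; exact hx)]
        simp only [map_mul, Polynomial.aeval_C, map_pow, Polynomial.aeval_X, eq_ratCast, mul_pow, hs]
      have h2 := dimOneRep_levelN_zero_mem_relations N₁ hN₁i
      have e : of N - of Nd - of N₁ = (of N - of Nd) - of N₁ := by abel
      rw [e]
      exact relations.sub_mem h1 h2
    · -- off-diagonal monomial: to dimension one
      have key : ∀ (a b : ℕ) (N : IntegralRep 2), b < a → N.domain = {x | ∀ i, x i ∈ Set.Ioo (0:ℝ) 1} →
          EqOn N.integrand (fun x => (c : ℝ) * (x 0 ^ a * x 1 ^ b) / (1 - (x 0 * x 1) ^ Nl)) N.domain →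
          ∃ (p₁ : ℚ[X]), ∀ (N₁ : IntegralRep 1), N₁.domain = {x | ∀ i, x i ∈ Set.Ioo (0:ℝ) 1} →
            EqOn N₁.integrand
              (fun x => (Polynomial.aeval (x 0) p₁ : ℝ) / ∑ i ∈ Finset.range Nl, x 0 ^ i) N₁.domain →
            of N - of N₁ ∈ relations := by
        intro a b N hab hNd hNi
        obtain ⟨p₁, N₁, hN₁d, hN₁i, h⟩ := offDiag_levelN_of_lt hN a b c hab N hNd hNi
        refine ⟨p₁, fun N₁' hN₁'d hN₁'i => ?_⟩
        have hc : of N₁ - of N₁' ∈ relations :=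
          of_sub_of_mem_relations_of_eqOn (hN₁'d.trans hN₁d.symm) fun x hx => by
            rw [hN₁i hx, hN₁'i (by rw [hN₁'d, ← hN₁d]; exact hx)]
        have e : of N - of N₁' = (of N - of N₁) + (of N₁ - of N₁') := by abel
        rw [e]
        exact relations.add_mem h hc
      have hoff : ∃ (p₁ : ℚ[X]), ∀ (N₁ : IntegralRep 1), N₁.domain = {x | ∀ i, x i ∈ Set.Ioo (0:ℝ) 1} →
          EqOn N₁.integrand
            (fun x => (Polynomial.aeval (x 0) p₁ : ℝ) / ∑ i ∈ Finset.range Nl, x 0 ^ i) N₁.domain →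
          of N - of N₁ ∈ relations := by
        rcases lt_or_gt_of_ne hs with h | h
        · let s' : Fin 2 →₀ ℕ := Finsupp.single 0 (s 1) + Finsupp.single 1 (s 0)
          obtain ⟨N', hN'd, hN'i⟩ := exists_levelNRep Nl hN (MvPolynomial.monomial s' c)
          have hN'i' : EqOn N'.integrand
              (fun x => (c : ℝ) * (x 0 ^ (s 1) * x 1 ^ (s 0)) / (1 - (x 0 * x 1) ^ Nl)) N'.domain :=
            fun x _ => by
              rw [hN'i]
              show (MvPolynomial.aeval x (MvPolynomial.monomial s' c) : ℝ) / (1 - (x 0 * x 1) ^ Nl) = _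
              rw [aeval_monomial_two]
              simp [s']
          have h1 := swap_monomial_levelN' (s 0) (s 1) c N N' hNd hNi' hN'd hN'i'
          obtain ⟨p₁, h2⟩ := key (s 1) (s 0) N' h hN'd hN'i'
          refine ⟨p₁, fun N₁ hN₁d hN₁i => ?_⟩
          have e : of N - of N₁ = (of N - of N') + (of N' - of N₁) := by abel
          rw [e]
          exact relations.add_mem h1 (h2 N₁ hN₁d hN₁i)
        · exact key (s 0) (s 1) N h hNd hNi'
      obtain ⟨p₁, hp₁⟩ := hoff
      refine ⟨0, p₁, fun Nd N₁ hNdd hNdi hN₁d hN₁i => ?_⟩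
      have e : of N - of Nd - of N₁ = (of N - of N₁) - of Nd := by abel
      rw [e]
      exact relations.sub_mem (hp₁ N₁ hN₁d hN₁i) (diagRep_levelN_zero_mem_relations Nd hNdi)
  | add P Q ihP ihQ =>
    intro N hNd hNi
    obtain ⟨NP, hNPd, hNPi⟩ := exists_levelNRep Nl hN P
    obtain ⟨NQ, hNQd, hNQi⟩ := exists_levelNRep Nl hN Q
    obtain ⟨D₁, p₁, h₁⟩ := ihP NP hNPd (by rw [hNPi]; exact fun _ _ => rfl)
    obtain ⟨D₂, p₂, h₂⟩ := ihQ NQ hNQd (by rw [hNQi]; exact fun _ _ => rfl)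
    refine ⟨D₁ + D₂, p₁ + p₂, fun Nd N₁ hNdd hNdi hN₁d hN₁i => ?_⟩
    have hsplit : of N - of NP - of NQ ∈ relations := by
      refine integrandAddRel_subset_relations ⟨2, N, NP, NQ, hNPd.trans hNd.symm,
        hNQd.trans hNd.symm, fun x hx => ?_, rfl⟩
      rw [Pi.add_apply, hNi hx, hNPi, hNQi]
      simp only [map_add]
      ring
    obtain ⟨B₁, hB₁d, hB₁i⟩ := exists_diagRep_levelN hN D₁
    obtain ⟨B₂, hB₂d, hB₂i⟩ := exists_diagRep_levelN hN D₂
    obtain ⟨L₁, hL₁d, hL₁i⟩ := exists_dimOneRep_levelN hN p₁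
    obtain ⟨L₂, hL₂d, hL₂i⟩ := exists_dimOneRep_levelN hN p₂
    have e₁ := h₁ B₁ L₁ hB₁d hB₁i hL₁d hL₁i
    have e₂ := h₂ B₂ L₂ hB₂d hB₂i hL₂d hL₂i
    have eB := diagRep_levelN_add_mem_relations Nd B₁ B₂ hNdd hNdi hB₁d hB₁i hB₂d hB₂i
    have eL := dimOneRep_levelN_add_mem_relations N₁ L₁ L₂ hN₁d hN₁i hL₁d hL₁i hL₂d hL₂i
    have e : of N - of Nd - of N₁ = (of N - of NP - of NQ) + (of NP - of B₁ - of L₁) +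
        (of NQ - of B₂ - of L₂) - (of Nd - of B₁ - of B₂) - (of N₁ - of L₁ - of L₂) := by abel
    rw [e]
    exact relations.sub_mem (relations.sub_mem (relations.add_mem (relations.add_mem hsplit e₁) e₂)
      eB) eL

/-! ### The relative kernel theorem -/

/-- **Every element of the subgroup generated by the full level-`N` sector and the rational
representations of dimension `≤ 1` is congruent to an element of the subgroup generated by the DIAGONAL
level-`N` sector and dimension `≤ 1`** (generator by generator: `levelN_reduce`).
[cite: KontsevichZagier2001, §1.2] -/
theorem exists_diag_sub_mem_relations_of_mem_closure (hN : 1 ≤ Nl) {c : FormalRep}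
    (hc : c ∈ AddSubgroup.closure
      ({y : FormalRep | ∃ (P : MvPolynomial (Fin 2) ℚ) (N : IntegralRep 2),
          N.domain = {x | ∀ i, x i ∈ Set.Ioo (0:ℝ) 1} ∧
          EqOn N.integrand (fun x => (MvPolynomial.aeval x P : ℝ) / (1 - (x 0 * x 1) ^ Nl)) N.domain ∧
          y = of N} ∪
       {y : FormalRep | ∃ (m : ℕ) (N : IntegralRep m), m ≤ 1 ∧ N.IsRational ∧ y = of N})) :
    ∃ c' ∈ AddSubgroup.closure
      ({y : FormalRep | ∃ (D : ℚ[X]) (Nd : IntegralRep 2),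
          Nd.domain = {x | ∀ i, x i ∈ Set.Ioo (0:ℝ) 1} ∧
          EqOn Nd.integrand (fun x => (Polynomial.aeval (x 0 * x 1) D : ℝ) / (1 - (x 0 * x 1) ^ Nl))
            Nd.domain ∧ y = of Nd} ∪
       {y : FormalRep | ∃ (m : ℕ) (N : IntegralRep m), m ≤ 1 ∧ N.IsRational ∧ y = of N}),
      c - c' ∈ relations := by
  induction hc using AddSubgroup.closure_induction with
  | mem y hy =>
    rcases hy with ⟨P, N, hNd, hNi, rfl⟩ | hy
    · obtain ⟨D, p₁, h⟩ := levelN_reduce hN P N hNd hNi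
      obtain ⟨Nd, hNdd, hNdi⟩ := exists_diagRep_levelN hN D
      obtain ⟨N₁, hN₁d, hN₁i⟩ := exists_dimOneRep_levelN hN p₁
      have hrat : N₁.IsRational := by
        refine Unicoord.isRational_of_aeval_div N₁ p₁ (∑ i ∈ Finset.range Nl, Polynomial.X ^ i)
          (fun x hx => ?_) (fun x hx => by rw [hN₁i hx]; dsimp only; rw [aeval_geomSum])
        rw [aeval_geomSum]
        have hx' : x 0 ∈ Set.Ioo (0:ℝ) 1 := by rw [hN₁d] at hx; exact hx 0
        exact (geomSum_pos_of_mem_Icc hN (Set.Ioo_subset_Icc_self hx')).ne'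
      refine ⟨of Nd + of N₁, AddSubgroup.add_mem _
        (AddSubgroup.subset_closure (Or.inl ⟨D, Nd, hNdd, hNdi, rfl⟩))
        (AddSubgroup.subset_closure (Or.inr ⟨1, N₁, le_rfl, hrat, rfl⟩)), ?_⟩
      have e : of N - (of Nd + of N₁) = of N - of Nd - of N₁ := by abel
      rw [e]
      exact h Nd N₁ hNdd hNdi hN₁d hN₁i
    · exact ⟨y, AddSubgroup.subset_closure (Or.inr hy), by rw [sub_self]; exact relations.zero_mem⟩
  | zero => exact ⟨0, AddSubgroup.zero_mem _, by rw [sub_self]; exact relations.zero_mem⟩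
  | add y z _ _ ihy ihz =>
    obtain ⟨y', hy', hyy'⟩ := ihy
    obtain ⟨z', hz', hzz'⟩ := ihz
    refine ⟨y' + z', AddSubgroup.add_mem _ hy' hz', ?_⟩
    have e : y + z - (y' + z') = (y - y') + (z - z') := by abel
    rw [e]
    exact relations.add_mem hyy' hzz'
  | neg y _ ih =>
    obtain ⟨y', hy', hyy'⟩ := ih
    refine ⟨-y', AddSubgroup.neg_mem _ hy', ?_⟩
    have e : -y - -y' = -(y - y') := by abel
    rw [e]
    exact relations.neg_mem hyy'

/-- **At every level `N`, Conjecture 1 (kernel form) on the full two-dimensional box sector reduces to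
the diagonal sector plus dimension `≤ 1`.** If every formal `ℤ`-combination of DIAGONAL level-`N` box
representations `[(0,1)², D(x₀x₁)/(1 − (x₀x₁)ᴺ)]` and of rational representations of dimension `≤ 1`
with value `0` is a relation, then the same holds with the FULL sector `[(0,1)², P(x₀,x₁)/(1 − (x₀x₁)ᴺ)]`
in place of the diagonal one. [cite: KontsevichZagier2001, §1.2 Conjecture 1] -/
theorem levelN_kernel_of_diag_kernel {Nl : ℕ} (hN : 1 ≤ Nl)
    (hK : ∀ c ∈ AddSubgroup.closure
      ({y : FormalRep | ∃ (D : ℚ[X]) (Nd : IntegralRep 2),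
          Nd.domain = {x | ∀ i, x i ∈ Set.Ioo (0:ℝ) 1} ∧
          EqOn Nd.integrand (fun x => (Polynomial.aeval (x 0 * x 1) D : ℝ) / (1 - (x 0 * x 1) ^ Nl))
            Nd.domain ∧ y = of Nd} ∪
       {y : FormalRep | ∃ (m : ℕ) (N : IntegralRep m), m ≤ 1 ∧ N.IsRational ∧ y = of N}),
      eval c = 0 → c ∈ relations)
    {c : FormalRep}
    (hc : c ∈ AddSubgroup.closure
      ({y : FormalRep | ∃ (P : MvPolynomial (Fin 2) ℚ) (N : IntegralRep 2),
          N.domain = {x | ∀ i, x i ∈ Set.Ioo (0:ℝ) 1} ∧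
          EqOn N.integrand (fun x => (MvPolynomial.aeval x P : ℝ) / (1 - (x 0 * x 1) ^ Nl)) N.domain ∧
          y = of N} ∪
       {y : FormalRep | ∃ (m : ℕ) (N : IntegralRep m), m ≤ 1 ∧ N.IsRational ∧ y = of N}))
    (hv : eval c = 0) : c ∈ relations := by
  obtain ⟨c', hc', hcc'⟩ := exists_diag_sub_mem_relations_of_mem_closure hN hc
  have hv' : eval c' = 0 := by
    have h := relations_le_ker_eval_holds hcc'
    rw [AddMonoidHom.mem_ker, map_sub, hv, zero_sub, neg_eq_zero] at h
    exact h
  have h' : c' ∈ relations := hK c' hc' hv'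
  have e : c = (c - c') + c' := by abel
  rw [e]
  exact relations.add_mem hcc' h'

end Summit.KontsevichZagierPeriods.HurwitzMicroSectors.NormalFormPrinciple.PiBox.LevelN
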